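import Literature.MathematicalPhysics.QuantumLattice.FinDimSpectrumProofs
import Literature.MathematicalPhysics.QuantumLattice.SectorEigenvalueContinuation
import HarnessLib

/-!
# The variational principle against an unnormalised trial vector; bond sums on regular graphs

Three elementary book-keeping facts used in uniform-trial-state (variational) upper bounds for
lattice ground-state energies:

* `groundSpace_rayleigh_mul_le` — **Rayleigh–Ritz in product form**: for a Hermitian matrix `K`
  and a unit ground vector `ψ`, `Re⟨ψ, Kψ⟩ · ‖φ‖² ≤ Re⟨φ, Kφ⟩` for EVERY vector `φ` (no
  normalisation of the trial vector needed);
* `sum_sum_sum_mul_comm` — Fubini for an expectation of a weighted double (bond) sum,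
  `Σ_i (Σ_x Σ_y a_{xy} g_i(x,y)) c_i = Σ_x Σ_y a_{xy} Σ_i c_i g_i(x,y)`;
* `regularGraph_sum_boole_half_sub_mul` — on a graph all of whose vertices have the same
  (indicator-sum) degree `δ`, the Ising-type bond sum `Σ_{x,y}[x∼y](½ - t_x)(½ - t_y)` equals the
  lattice-gas bond sum `Σ_{x,y}[x∼y](1 - t_x)(1 - t_y)` minus `δ Σ_x (1 - t_x)` plus `δ|Λ|/4`
  (the usual Ising ↔ lattice-gas dictionary `s_x = n_x - ½`).

## Sources

Folklore. The variational principle: H. Tasaki, *Physics and Mathematics of Quantum Many-Body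
Systems* (Springer, 2020), §2.1, eq. (2.1.6); E. H. Lieb, R. Seiringer, J. P. Solovej, J. Yngvason,
*The Mathematics of the Bose Gas and its Condensation* (2005), Ch. 5. The Ising/lattice-gas
dictionary: S. Friedli, Y. Velenik, *Statistical Mechanics of Lattice Systems* (2017), §4.1.
-/

noncomputable section

namespace Literature.MathematicalPhysics.QuantumLattice

open scoped BigOperators Matrix ComplexOrder
open _root_.Matrix _root_.Finset

/-- **Variational principle (Rayleigh–Ritz) in product form.** For a Hermitian matrix `K` and a
unit ground vector `ψ` (`Kψ = E₀ψ`, `‖ψ‖ = 1`), `Re⟨ψ, Kψ⟩ · ‖φ‖² ≤ Re⟨φ, Kφ⟩` for every vector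
`φ`: normalise `φ ≠ 0` and use `E₀ ≤ ⟨φ̂, Kφ̂⟩` (`Matrix.groundEnergy_le_rayleigh_holds`).
Tasaki (2020) §2.1, (2.1.6). [folklore] -/
theorem groundSpace_rayleigh_mul_le {ι : Type*} [Fintype ι] [DecidableEq ι] {K : Matrix ι ι ℂ}
    (hK : K.IsHermitian) {ψ : ι → ℂ} (hψ : ψ ∈ K.groundSpace) (hψ1 : star ψ ⬝ᵥ ψ = 1)
    (φ : ι → ℂ) :
    (star ψ ⬝ᵥ K *ᵥ ψ).re * (star φ ⬝ᵥ φ).re ≤ (star φ ⬝ᵥ K *ᵥ φ).re := by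
  have hKψ : K *ᵥ ψ = (K.groundEnergy : ℂ) • ψ := (Matrix.mem_groundSpace_iff K ψ).1 hψ
  have hE : (star ψ ⬝ᵥ K *ᵥ ψ).re = K.groundEnergy := by
    rw [EigenvalueContinuation.re_star_dotProduct_mulVec_of_eigen hKψ, hψ1, Complex.one_re, mul_one]
  rw [hE]
  by_cases hφ : φ = 0
  · subst hφ
    simp
  obtain ⟨c, -, hcc, hc1⟩ := EigenvalueContinuation.exists_normalize hφ
  have h := Matrix.groundEnergy_le_rayleigh_holds hK _ hc1
  rw [mulVec_smul, EigenvalueContinuation.star_real_smul_dotProduct_real_smul,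
    Complex.re_ofReal_mul] at h
  calc K.groundEnergy * (star φ ⬝ᵥ φ).re
      ≤ c * c * (star φ ⬝ᵥ K *ᵥ φ).re * (star φ ⬝ᵥ φ).re :=
        mul_le_mul_of_nonneg_right h (EigenvalueContinuation.re_star_dotProduct_self_nonneg φ)
    _ = c * c * (star φ ⬝ᵥ φ).re * (star φ ⬝ᵥ K *ᵥ φ).re := by ring
    _ = (star φ ⬝ᵥ K *ᵥ φ).re := by rw [hcc, one_mul]

/-- **Fubini for the expectation of a weighted bond sum**:
`Σ_i (Σ_x Σ_y a_{xy} g_i(x,y)) c_i = Σ_x Σ_y a_{xy} Σ_i c_i g_i(x,y)`. [folklore] -/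
theorem sum_sum_sum_mul_comm {ι κ : Type*} [Fintype ι] [Fintype κ] (a : κ → κ → ℝ)
    (g : ι → κ → κ → ℝ) (c : ι → ℝ) :
    ∑ i, (∑ x, ∑ y, a x y * g i x y) * c i = ∑ x, ∑ y, a x y * ∑ i, c i * g i x y := by
  calc ∑ i, (∑ x, ∑ y, a x y * g i x y) * c i
      = ∑ i, ∑ x, ∑ y, a x y * (c i * g i x y) := by
        refine Finset.sum_congr rfl fun i _ => ?_
        rw [Finset.sum_mul]
        refine Finset.sum_congr rfl fun x _ => ?_
        rw [Finset.sum_mul]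
        refine Finset.sum_congr rfl fun y _ => ?_
        ring
    _ = ∑ x, ∑ i, ∑ y, a x y * (c i * g i x y) := Finset.sum_comm
    _ = ∑ x, ∑ y, ∑ i, a x y * (c i * g i x y) :=
        Finset.sum_congr rfl fun x _ => Finset.sum_comm
    _ = ∑ x, ∑ y, a x y * ∑ i, c i * g i x y := by simp only [Finset.mul_sum]

/-- **Ising ↔ lattice-gas bond sums on a regular graph.** If `Σ_u [v ∼ u] = δ` for every vertex
`v` (`[v ∼ u]` the real adjacency indicator), then for every `t : Λ → ℝ`,
`Σ_{x,y}[x∼y](½ - t_x)(½ - t_y) = Σ_{x,y}[x∼y](1 - t_x)(1 - t_y) - δ Σ_x (1 - t_x) + δ|Λ|/4`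
(expand `(n_x - ½)(n_y - ½)` with `n = 1 - t` and use `Σ_y [x∼y] = Σ_y [y∼x] = δ`).
Friedli–Velenik (2017) §4.1. [folklore] -/
theorem regularGraph_sum_boole_half_sub_mul {Λ : Type*} [Fintype Λ] (G : SimpleGraph Λ)
    [DecidableRel G.Adj] {δ : ℝ} (hreg : ∀ v, ∑ u, (if G.Adj v u then (1 : ℝ) else 0) = δ)
    (t : Λ → ℝ) :
    ∑ x, ∑ y, (if G.Adj x y then (1 : ℝ) else 0) * ((1 / 2 - t x) * (1 / 2 - t y)) =
      ∑ x, ∑ y, (if G.Adj x y then (1 : ℝ) else 0) * ((1 - t x) * (1 - t y)) -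
        δ * ∑ x, (1 - t x) + δ * Fintype.card Λ / 4 := by
  have hsymm : ∀ x y, (if G.Adj x y then (1 : ℝ) else 0) = if G.Adj y x then 1 else 0 := by
    intro x y
    by_cases h : G.Adj x y
    · rw [if_pos h, if_pos h.symm]
    · rw [if_neg h, if_neg fun h' => h h'.symm]
  have hlin1 : ∑ x, ∑ y, (if G.Adj x y then (1 : ℝ) else 0) * (1 - t x) = δ * ∑ x, (1 - t x) := by
    rw [Finset.mul_sum]
    refine Finset.sum_congr rfl fun x _ => ?_
    rw [← Finset.sum_mul, hreg x]
  have hlin2 : ∑ x, ∑ y, (if G.Adj x y then (1 : ℝ) else 0) * (1 - t y) = δ * ∑ x, (1 - t x) := by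
    rw [Finset.sum_comm, Finset.mul_sum]
    refine Finset.sum_congr rfl fun y _ => ?_
    rw [← Finset.sum_mul, Finset.sum_congr rfl fun x _ => hsymm x y, hreg y]
  have hconst : ∑ x, ∑ y, (if G.Adj x y then (1 : ℝ) else 0) = Fintype.card Λ * δ := by
    rw [Finset.sum_congr rfl fun x _ => hreg x, Finset.sum_const, Finset.card_univ, nsmul_eq_mul]
  have hexp : ∀ x y, (if G.Adj x y then (1 : ℝ) else 0) * ((1 / 2 - t x) * (1 / 2 - t y)) =
      (if G.Adj x y then (1 : ℝ) else 0) * ((1 - t x) * (1 - t y)) -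
        1 / 2 * ((if G.Adj x y then (1 : ℝ) else 0) * (1 - t x)) -
        1 / 2 * ((if G.Adj x y then (1 : ℝ) else 0) * (1 - t y)) +
        1 / 4 * (if G.Adj x y then (1 : ℝ) else 0) := by
    intro x y
    ring
  simp only [hexp, Finset.sum_add_distrib, Finset.sum_sub_distrib, ← Finset.mul_sum]
  rw [hlin1, hlin2, hconst]
  simp only [Finset.sum_sub_distrib]
  ring

end Literature.MathematicalPhysics.QuantumLattice

end
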